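import Summits.ABC.StewartYu.KummerBasisChange
import Summits.ABC.StewartYu.MonomialDenominators
import Literature.Barriers.ABC.BakerMethodBoundsPrimeLogFormsProofs
import HarnessLib

/-!
# Cell abc-stewartyu, WP-L.P(odd) (RouteGA crux `PadicCoreOddRat`, Kummer-free `p`-adic core over `ℚ`): SATURATED
# COORDINATES — values, valuations, common denominators and heights of the monomials `∏ θᵢ^{μᵢ}` of a saturated
# basis `θ` through the VIRTUAL exponents `ν(μ) = μ ᵥ* U` w.r.t. the original generators `α`

`Summits/ABC/StewartYu/SatCoords.lean` — cell `abc-stewartyu` (HOME `run/shared/lean/pub/abc-stewartyu/`, design memo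
HOME/p2/memo-07-WPLP-odd-Nframe-design.md §1 (L1)–(L3); seat p2-g5).  Theorems and one definition-free API; no named fact,
place-free arithmetic of `ℚ`.  Kill test K1 of the memo.

Setting (Nesterenko 2003 §3.5/§4.3, Yu 2013 p. 319): `α₁,…,αₙ` positive rationals, `𝔑 = {λ ∈ ℚⁿ : α^λ ∈ ℚ}` their
saturated exponent lattice, `N = [𝔑 : ℤⁿ]`, `θᵢ = α^{uᵢ}` for a basis `ū` of `𝔑` (a saturated, hence Kummer, system of
generators — `Literature…KummerSaturated.exists_saturated_basis_rat`).  Since `N𝔑 ⊆ ℤⁿ`, the INTEGER matrix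
`U = N·(uᵢⱼ)` satisfies `θᵢ^N = ∏ⱼ αⱼ^{Uᵢⱼ}`; this file takes exactly that relation as its hypothesis (`hU`) and proves, for
every integer exponent vector `μ` (θ-coordinates) with VIRTUAL exponent vector `ν = μ ᵥ* U` (`= N·λ`, `λ` the
α-coordinates of the same group element):

* (L1) `prod_zpow_pow_eq` — `(∏ θᵢ^{μᵢ})^N = ∏ αⱼ^{νⱼ}`;
* (L2) `natCast_mul_padicValRat_prod_zpow` — valuations are LINEAR in the virtual exponents:
  `N · ord_q(∏ θᵢ^{μᵢ}) = Σⱼ νⱼ · ord_q(αⱼ)` for every prime `q`;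
* `exists_int_monDen_mul_prod_zpow_sat` — the landed common denominator `monDen α E` of the α-box `|eⱼ| ≤ Eⱼ`
  (`MonomialDenominators.lean`) clears EVERY `∏ θᵢ^{μᵢ}` whose virtual exponents satisfy `|νⱼ| ≤ N·Eⱼ`, with the SAME
  numerator bound `(monDen α E)²` — so the k-step / START Liouville data of the landed odd frame keep their shape and their
  numbers on the skew family `{μ : |νⱼ(μ)| ≤ N·Eⱼ}` (= `𝔑 ∩ box` in θ-coordinates); this is print's Lemma 3.11;
* (L3) `natCast_mul_logHeight₁_prod_zpow_le` — `N · h(∏ θᵢ^{μᵢ}) ≤ Σⱼ |νⱼ| · h(αⱼ)`;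
* `prod_zpow_vecMul_eq` — the coefficient transport `∏ θᵢ^{(b ᵥ* C)ᵢ} = ∏ αⱼ^{bⱼ}` for `αⱼ = ∏ θᵢ^{Cⱼᵢ}` (the frame's
  `b̃ = Cᵀb`), and `exists_int_of_forall_padicValRat_nonneg` (integrality from valuations).

WHAT THIS IS NOT: no lattice, no basis reduction (memo row `SatBasisReduced`), no `p`-adic analysis, no frame; nothing about
the index `N` beyond `0 < N`.

References: Yu. V. Nesterenko, LNM 1819 (2003), §3.5 (p. 105, `N𝔑 ⊂ ℤⁿ`), Lemma 3.11, §4.3 (4.50); K. Yu, Acta Math. 211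
(2013) §1.1 p. 319.
-/

noncomputable section

open Finset
open scoped Matrix

namespace Summit.ABC.StewartYu.SatCoords

open Summit.ABC.StewartYu.MonomialDen (qsize monDen one_le_qsize)

variable {n : ℕ}

/-! ### Integrality from valuations -/

/-- A rational number all of whose `q`-adic valuations are non-negative is an integer. [folklore] -/
theorem exists_int_of_forall_padicValRat_nonneg (x : ℚ) (h : ∀ q : ℕ, q.Prime → 0 ≤ padicValRat q x) :
    ∃ z : ℤ, (z : ℚ) = x := by
  suffices hden : x.den = 1 by
    exact ⟨x.num, by rw [← Rat.num_div_den x, hden]; simp⟩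
  refine Nat.eq_one_iff_not_exists_prime_dvd.mpr fun q hq hqd => ?_
  haveI : Fact q.Prime := ⟨hq⟩
  have hv := h q hq
  have hcop : ¬ (q : ℤ) ∣ x.num := fun hn =>
    hq.ne_one (Nat.eq_one_of_dvd_coprimes x.reduced (Int.ofNat_dvd_left.mp hn) hqd)
  rw [padicValRat_def, padicValInt.eq_zero_of_not_dvd hcop] at hv
  have hden : 1 ≤ padicValNat q x.den := one_le_padicValNat_of_dvd x.den_nz hqd
  omega

/-- The valuation of the size `|a|·c` of `q = a/c ≠ 0` is `|ord(q)|`: exactly one of `a`, `c` carries the prime.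
[folklore] -/
theorem padicValRat_qsize {ℓ : ℕ} [Fact ℓ.Prime] {q : ℚ} (hq : q ≠ 0) :
    padicValRat ℓ (qsize q : ℚ) = |padicValRat ℓ q| := by
  have hnum : q.num ≠ 0 := Rat.num_ne_zero.mpr hq
  have hden : q.den ≠ 0 := q.den_nz
  have hnumQ : ((q.num.natAbs : ℕ) : ℚ) ≠ 0 := by exact_mod_cast Int.natAbs_ne_zero.mpr hnum
  have hdenQ : ((q.den : ℕ) : ℚ) ≠ 0 := by exact_mod_cast hden
  unfold qsize
  push_cast
  rw [padicValRat.mul hnumQ hdenQ]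
  have h1 : padicValRat ℓ ((q.num.natAbs : ℕ) : ℚ) = padicValNat ℓ q.num.natAbs := (padicValRat_of_nat _).symm
  have h2 : padicValRat ℓ ((q.den : ℕ) : ℚ) = padicValNat ℓ q.den := (padicValRat_of_nat _).symm
  rw [h1, h2]
  have hv : padicValRat ℓ q = (padicValInt ℓ q.num : ℤ) - padicValNat ℓ q.den := padicValRat_def ℓ q
  have hvi : (padicValInt ℓ q.num : ℤ) = padicValNat ℓ q.num.natAbs := rfl
  rw [hv, hvi]
  -- coprimality: not both valuations are positive
  rcases Nat.eq_zero_or_pos (padicValNat ℓ q.num.natAbs) with ha | ha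
  · rw [ha, Nat.cast_zero, zero_add, zero_sub, abs_neg, abs_of_nonneg (Nat.cast_nonneg _)]
  · have hℓa : ℓ ∣ q.num.natAbs := dvd_of_one_le_padicValNat ha
    have hℓc : ¬ ℓ ∣ q.den := fun hd =>
      (Fact.out : ℓ.Prime).ne_one (Nat.eq_one_of_dvd_coprimes q.reduced hℓa hd)
    have hc : padicValNat ℓ q.den = 0 := padicValNat.eq_zero_of_not_dvd hℓc
    rw [hc, Nat.cast_zero, sub_zero, add_zero, abs_of_nonneg (Nat.cast_nonneg _)]

/-! ### Monomials of a saturated basis through the virtual exponents -/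

section

variable (α θ : Fin n → ℚ) (U : Matrix (Fin n) (Fin n) ℤ) (N : ℕ)

/-- **(L1) Values.** If `θᵢ^N = ∏ⱼ αⱼ^{Uᵢⱼ}` then `(∏ᵢ θᵢ^{μᵢ})^N = ∏ⱼ αⱼ^{(μ ᵥ* U)ⱼ}`.
[cite: Nesterenko2003, §4.3 (4.50); shape only] -/
theorem prod_zpow_pow_eq (hα : ∀ j, α j ≠ 0) (hU : ∀ i, θ i ^ N = ∏ j, α j ^ U i j) (μ : Fin n → ℤ) :
    (∏ i, θ i ^ μ i) ^ N = ∏ j, α j ^ (μ ᵥ* U) j := by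
  have h1 : (∏ i, θ i ^ μ i) ^ N = ∏ i, (θ i ^ N) ^ μ i := by
    rw [← Finset.prod_pow]
    refine Finset.prod_congr rfl fun i _ => ?_
    rw [← zpow_natCast, ← zpow_natCast, ← _root_.zpow_mul, ← _root_.zpow_mul, mul_comm]
  rw [h1, KummerBasisChange.prod_zpow_basisChange α hα U (fun i => θ i ^ N) hU μ]
  rfl

/-- **The coefficient transport** `b̃ = Cᵀb`: if `αⱼ = ∏ᵢ θᵢ^{Cⱼᵢ}` then `∏ᵢ θᵢ^{(b ᵥ* C)ᵢ} = ∏ⱼ αⱼ^{bⱼ}`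
(so `ord_p(θ^{b̃} − 1) = ord_p(α^b − 1)` and `Σ b̃ᵢ log θᵢ = Σ bⱼ log αⱼ`). [cite: Nesterenko2003, Cor 4.5; shape only] -/
theorem prod_zpow_vecMul_eq (hθ : ∀ i, θ i ≠ 0) (C : Matrix (Fin n) (Fin n) ℤ) (hC : ∀ j, α j = ∏ i, θ i ^ C j i)
    (b : Fin n → ℤ) : ∏ i, θ i ^ (b ᵥ* C) i = ∏ j, α j ^ b j := by
  rw [KummerBasisChange.prod_zpow_basisChange θ hθ C α hC b]
  rfl

/-- The monomials of positive generators are positive. [folklore] -/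
theorem prod_zpow_pos (hθ : ∀ i, 0 < θ i) (μ : Fin n → ℤ) : 0 < ∏ i, θ i ^ μ i :=
  Finset.prod_pos fun i _ => zpow_pos (hθ i) _

/-- **(L2) Valuations are linear in the virtual exponents**: `N · ord_q(∏ θᵢ^{μᵢ}) = Σⱼ (μ ᵥ* U)ⱼ · ord_q(αⱼ)`.
[cite: Nesterenko2003, Lemma 3.11; shape only] -/
theorem natCast_mul_padicValRat_prod_zpow {q : ℕ} [Fact q.Prime] (hα : ∀ j, α j ≠ 0)
    (hU : ∀ i, θ i ^ N = ∏ j, α j ^ U i j) (μ : Fin n → ℤ) :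
    (N : ℤ) * padicValRat q (∏ i, θ i ^ μ i) = ∑ j, (μ ᵥ* U) j * padicValRat q (α j) := by
  have h := congrArg (padicValRat q) (prod_zpow_pow_eq α θ U N hα hU μ)
  rw [padicValRat.pow (∏ i, θ i ^ μ i),
    Literature.Barriers.ABC.padicValRat_finset_prod _ _ fun j _ => zpow_ne_zero _ (hα j)] at h
  rw [h]
  refine Finset.sum_congr rfl fun j _ => ?_
  rw [padicValRat.zpow]

/-- For a positive rational `a` and an integer `k`: `a^k ≤ (qsize a)^{|k|}` (`a ≤ |num a|`, `a⁻¹ ≤ den a`). [folklore] -/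
theorem zpow_le_qsize_pow {a : ℚ} (ha : 0 < a) (k : ℤ) : a ^ k ≤ (qsize a : ℚ) ^ k.natAbs := by
  have ha0 : a ≠ 0 := ha.ne'
  have hnum : 0 < a.num := Rat.num_pos.mpr ha
  have hden : (0 : ℚ) < a.den := by exact_mod_cast a.den_pos
  have hq : (qsize a : ℚ) = (a.num : ℚ) * a.den := by
    unfold qsize; push_cast; rw [Nat.cast_natAbs, abs_of_pos (by exact_mod_cast hnum)]
  have hnum1 : (1 : ℚ) ≤ a.num := by exact_mod_cast hnum
  have hden1 : (1 : ℚ) ≤ a.den := by exact_mod_cast a.den_pos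
  have hmul : a * a.den = a.num := Rat.mul_den_eq_num a
  -- `a ≤ qsize a` and `a⁻¹ ≤ qsize a`
  have hle : a ≤ qsize a := by
    rw [hq]
    calc a ≤ a * a.den := le_mul_of_one_le_right ha.le hden1
      _ = a.num := hmul
      _ ≤ a.num * a.den := le_mul_of_one_le_right (by exact_mod_cast hnum.le) hden1
  have hle' : a⁻¹ ≤ qsize a := by
    rw [hq]
    have hinv : a⁻¹ * a.num = a.den := by
      rw [← hmul]; field_simp
    calc a⁻¹ ≤ a⁻¹ * a.num := le_mul_of_one_le_right (inv_nonneg.mpr ha.le) hnum1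
      _ = a.den := hinv
      _ ≤ a.num * a.den := le_mul_of_one_le_left hden.le hnum1
  rcases Int.natAbs_eq k with hk | hk
  · rw [hk, zpow_natCast, Int.natAbs_natCast]
    exact pow_le_pow_left₀ ha.le hle _
  · rw [hk, _root_.zpow_neg, zpow_natCast, Int.natAbs_neg, Int.natAbs_natCast, ← inv_pow]
    exact pow_le_pow_left₀ (inv_nonneg.mpr ha.le) hle' _

/-- **The virtual common denominator (print's Lemma 3.11).**  For positive `α`, `θ` with `θᵢ^N = ∏ αⱼ^{Uᵢⱼ}`, `0 < N`,
and an integer exponent vector `μ` whose virtual exponents satisfy `|(μ ᵥ* U)ⱼ| ≤ N·Eⱼ`: the landed box denominator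
`monDen α E` clears `∏ θᵢ^{μᵢ}`, with numerator `≤ (monDen α E)²` — the statement of
`MonomialDen.exists_int_monDen_mul_prod_zpow` for the skew family `𝔑 ∩ box` in θ-coordinates, same constant.
[cite: Nesterenko2003, Lemma 3.11; shape only] -/
theorem exists_int_monDen_mul_prod_zpow_sat (hα : ∀ j, 0 < α j) (hθ : ∀ i, 0 < θ i) (hN : 0 < N)
    (hU : ∀ i, θ i ^ N = ∏ j, α j ^ U i j) (E : Fin n → ℕ) (μ : Fin n → ℤ)
    (hμ : ∀ j, |(μ ᵥ* U) j| ≤ (N : ℤ) * E j) :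
    ∃ z : ℤ, ((monDen α E : ℕ) : ℚ) * ∏ i, θ i ^ μ i = z ∧ |z| ≤ ((monDen α E : ℤ)) ^ 2 := by
  have hα0 : ∀ j, α j ≠ 0 := fun j => (hα j).ne'
  set r : ℚ := ∏ i, θ i ^ μ i with hr
  have hr0 : 0 < r := prod_zpow_pos θ hθ μ
  have hD1 : 1 ≤ monDen α E := MonomialDen.one_le_monDen α hα0 E
  have hD0 : ((monDen α E : ℕ) : ℚ) ≠ 0 := by exact_mod_cast (show monDen α E ≠ 0 by omega)
  -- integrality, prime by prime
  obtain ⟨z, hz⟩ : ∃ z : ℤ, (z : ℚ) = ((monDen α E : ℕ) : ℚ) * r := by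
    refine exists_int_of_forall_padicValRat_nonneg _ fun q hq => ?_
    haveI : Fact q.Prime := ⟨hq⟩
    rw [padicValRat.mul hD0 hr0.ne']
    -- `N · (ord_q D + ord_q r) = Σⱼ (N Eⱼ |ord_q αⱼ| + νⱼ ord_q αⱼ) ≥ 0`
    have hD : padicValRat q ((monDen α E : ℕ) : ℚ) = ∑ j, (E j : ℤ) * |padicValRat q (α j)| := by
      unfold monDen
      push_cast
      rw [Literature.Barriers.ABC.padicValRat_finset_prod _ _ fun j _ =>
        pow_ne_zero _ (by exact_mod_cast (show qsize (α j) ≠ 0 by have := one_le_qsize (hα0 j); omega))]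
      refine Finset.sum_congr rfl fun j _ => ?_
      rw [padicValRat.pow ((qsize (α j) : ℕ) : ℚ), padicValRat_qsize (hα0 j)]
    have hNr : (N : ℤ) * padicValRat q r = ∑ j, (μ ᵥ* U) j * padicValRat q (α j) :=
      natCast_mul_padicValRat_prod_zpow α θ U N hα0 hU μ
    have hsum : 0 ≤ (N : ℤ) * (padicValRat q ((monDen α E : ℕ) : ℚ) + padicValRat q r) := by
      rw [mul_add, hNr, hD, Finset.mul_sum, ← Finset.sum_add_distrib]
      refine Finset.sum_nonneg fun j _ => ?_
      have h1 := hμ j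
      have h2 : -(|(μ ᵥ* U) j| * |padicValRat q (α j)|) ≤ (μ ᵥ* U) j * padicValRat q (α j) := by
        rw [← abs_mul]; exact neg_abs_le _
      have h3 : |(μ ᵥ* U) j| * |padicValRat q (α j)| ≤ (N : ℤ) * E j * |padicValRat q (α j)| :=
        mul_le_mul_of_nonneg_right h1 (abs_nonneg _)
      nlinarith [abs_nonneg (padicValRat q (α j))]
    have hN' : (0 : ℤ) < N := by exact_mod_cast hN
    exact nonneg_of_mul_nonneg_right hsum hN'
  refine ⟨z, hz.symm, ?_⟩
  -- size: `r ≤ monDen α E` from `r^N = ∏ αⱼ^{νⱼ} ≤ ∏ qsize(αⱼ)^{N Eⱼ} = (monDen α E)^N`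
  have hrle : r ≤ (monDen α E : ℕ) := by
    have hpow : r ^ N ≤ (((monDen α E : ℕ) : ℚ)) ^ N := by
      rw [hr, prod_zpow_pow_eq α θ U N hα0 hU μ]
      unfold monDen
      push_cast
      rw [← Finset.prod_pow]
      refine Finset.prod_le_prod (fun j _ => (zpow_pos (hα j) _).le) fun j _ => ?_
      calc α j ^ (μ ᵥ* U) j ≤ (qsize (α j) : ℚ) ^ ((μ ᵥ* U) j).natAbs := zpow_le_qsize_pow (hα j) _
        _ ≤ (qsize (α j) : ℚ) ^ (N * E j) := by
            refine pow_le_pow_right₀ (by exact_mod_cast one_le_qsize (hα0 j)) ?_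
            have h' := hμ j
            rw [Int.abs_eq_natAbs] at h'
            exact_mod_cast h'
        _ = ((qsize (α j) : ℚ) ^ E j) ^ N := by rw [← pow_mul, mul_comm]
    exact le_of_pow_le_pow_left₀ (by omega) (by exact_mod_cast (Nat.zero_le _)) hpow
  have hzQ : |(z : ℚ)| ≤ (((monDen α E : ℤ)) ^ 2 : ℤ) := by
    rw [hz, abs_of_pos (mul_pos (by exact_mod_cast (show 0 < monDen α E by omega)) hr0)]
    push_cast
    rw [sq]
    exact mul_le_mul_of_nonneg_left hrle (by exact_mod_cast (Nat.zero_le _))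
  exact_mod_cast hzQ

/-- **(L3) Heights are sub-linear in the virtual exponents**: `N · h(∏ θᵢ^{μᵢ}) ≤ Σⱼ |(μ ᵥ* U)ⱼ| · h(αⱼ)`.
[cite: Nesterenko2003, §3.2 / Lemma 3.11; shape only] -/
theorem natCast_mul_logHeight₁_prod_zpow_le (hα : ∀ j, α j ≠ 0) (hU : ∀ i, θ i ^ N = ∏ j, α j ^ U i j)
    (μ : Fin n → ℤ) :
    (N : ℝ) * Height.logHeight₁ (∏ i, θ i ^ μ i) ≤ ∑ j, (|(μ ᵥ* U) j| : ℝ) * Height.logHeight₁ (α j) := by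
  rw [← Height.logHeight₁_pow, prod_zpow_pow_eq α θ U N hα hU μ]
  refine (Height.logHeight₁_prod_le _ _).trans (Finset.sum_le_sum fun j _ => ?_)
  rw [Height.logHeight₁_zpow, Nat.cast_natAbs, Int.cast_abs]

/-- **(L3′) The box form**: if `|(μ ᵥ* U)ⱼ| ≤ N·Eⱼ` and `h(αⱼ) ≤ Vⱼ` then `h(∏ θᵢ^{μᵢ}) ≤ Σⱼ Eⱼ·Vⱼ` (`0 < N`) — the
landed "box height" ceiling `Σ sideⱼ·Vⱼ`, now for the skew family. [cite: Nesterenko2003, Lemma 3.11; shape only] -/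
theorem logHeight₁_prod_zpow_le_of_sat (hα : ∀ j, α j ≠ 0) (hN : 0 < N)
    (hU : ∀ i, θ i ^ N = ∏ j, α j ^ U i j) (E : Fin n → ℕ) (V : Fin n → ℝ)
    (hV : ∀ j, Height.logHeight₁ (α j) ≤ V j) (μ : Fin n → ℤ) (hμ : ∀ j, |(μ ᵥ* U) j| ≤ (N : ℤ) * E j) :
    Height.logHeight₁ (∏ i, θ i ^ μ i) ≤ ∑ j, (E j : ℝ) * V j := by
  have hN' : (0 : ℝ) < N := by exact_mod_cast hN
  have h := natCast_mul_logHeight₁_prod_zpow_le α θ U N hα hU μ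
  have h2 : ∑ j, (|(μ ᵥ* U) j| : ℝ) * Height.logHeight₁ (α j) ≤ ∑ j, (N : ℝ) * ((E j : ℝ) * V j) := by
    refine Finset.sum_le_sum fun j _ => ?_
    have h0 : 0 ≤ Height.logHeight₁ (α j) := Height.zero_le_logHeight₁ _
    have h1 : (|(μ ᵥ* U) j| : ℝ) ≤ (N : ℝ) * E j := by exact_mod_cast hμ j
    calc (|(μ ᵥ* U) j| : ℝ) * Height.logHeight₁ (α j) ≤ (N : ℝ) * E j * Height.logHeight₁ (α j) :=
          mul_le_mul_of_nonneg_right h1 h0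
      _ ≤ (N : ℝ) * E j * V j := mul_le_mul_of_nonneg_left (hV j) (by positivity)
      _ = (N : ℝ) * ((E j : ℝ) * V j) := by ring
  rw [← Finset.mul_sum] at h2
  exact le_of_mul_le_mul_left (h.trans h2) hN'

end

end Summit.ABC.StewartYu.SatCoords

end
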